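/-
Copyright: H21 K2-LIT squad (hodgecm-mathlib). Helper for crux hLiu418 = `stmt-HodgeConjecture-24832`
(route `route-HodgeConjecture-HCCMUnconditional`), G-road arch debt «(D-ht)» (LEAD ruling «M-156h», G2-PS-B, file B1).
-/
import Summits.HodgeConjecture.HodgeConjecture.Theorems.K2LiuArchOneParameterOrbitDefs              -- ★ `archExp`, `archEmb`, `finEmb`
import Summits.HodgeConjecture.HodgeConjecture.Theorems.K2LiuSiegelGramDeterminant                  -- ★ B2: `siegelGram` and its invariances
import Summits.HodgeConjecture.HodgeConjecture.Theorems.K2LiuIwasawaHeightContinuous                -- ★ `iwasawaHeight_*` (Φ_𝒦 algebra), unimodularity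
import Summits.HodgeConjecture.HodgeConjecture.Theorems.K2LiuSiegelMainOrbitOpenEmbeddingArchPrelims -- ★ `isSiegelDelta_archToAdelic_iff`
import Literature.NumberTheory.K2Lit.SiegelStandardIwasawaData                                       -- ★ `IwasawaDatum.IsStd` (P0)–(P2)
import Literature.NumberTheory.GelbartRogawski1991.DoubledWeilRepresentationArchTwist               -- ★ `modDelta_archToAdelic_sq`
import Literature.NumberTheory.GelbartRogawski1991.DoubledUnitaryArchSiegelDiagonalModulus          -- ★ `placeOver`, `complexConj_smul_infinitePlace`
import HarnessLib

/-!
# The Iwasawa height along archimedean orbits: reduction to the archimedean Gram determinant (STANDARD data)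

For a STANDARD Iwasawa datum `𝒦` of `H(𝔸) = U(𝕍 ⊕ −𝕍)(𝔸)` (★ `IwasawaDatum.IsStd`: `𝒦.K = C_∞ · C_f` with `C_f` open and
`C_∞ = H_∞ ∩ S·U(2n)·S⁻¹` the stabiliser of a positive majorant with frame `S`) and the Iwasawa height
`Φ_𝒦 h := modDelta (𝒦.pPart h) = |det_Δ p_h|^{1/2}` (★ `K2LiuIwasawaHeightContinuous`):

1. `iwasawaHeight_mul_archExp` — along the orbit `h · γ_X(t)` (`γ_X = archExp`, ★ `K2LiuArchOneParameterOrbitDefs`) the height factors as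
   `Φ_𝒦 (h · γ_X t) = Φ_𝒦 h · Φ_𝒦 ((c_h · exp tX, 1))` with `c_h = (𝒦.kPart h)_∞ ∈ C_∞` (Iwasawa `h = p k`, `k = (k_∞,1)(1,k_f)` by (P0), ★ `archEmb ∕ finEmb`);
2. `iwasawaHeight_archEmb_eq` — for `y ∈ H_∞`, `Φ_𝒦 ((y,1)) = modDelta ((y c⁻¹, 1))` with `c = (𝒦.kPart (y,1))_∞ ∈ C_∞` and `(y c⁻¹, 1) ∈ P_Δ(𝔸)`
   (the finite part of the Iwasawa `P`-part of an archimedean element lies in `K ∩ P_Δ`, where `modDelta = 1` by unimodularity);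
3. `normSq_detDeltaM_eq_siegelGram_div` — at a complex place `w`, for `g = y c⁻¹ ∈ P_∞` and `S⁻¹ c S` unitary:
   `‖det_Δ g_w‖² = siegelGram S_w⁻¹ 1 ∕ siegelGram S_w⁻¹ y_w⁻¹` (★ B2: unitary invariance + `P_Δ`-equivariance + positivity);
4. **`iwasawaHeight_archEmb_sq`** — `Φ_𝒦 ((y,1))² = ∏_{v real ∣ L⁺} siegelGram S_{w(v)}⁻¹ 1 ∕ siegelGram S_{w(v)}⁻¹ y_{w(v)}⁻¹` (★ `modDelta_archToAdelic_sq`),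
   a real-analytic function of `y⁻¹` — the input of the derivative file B3.

[cite: KudlaRallis1994, §1 (`|a(g)|` through the Iwasawa decomposition)] [cite: Weil1964, Chap. I n° 8 (majorants)] [cite: Tan1999, §1 p. 166]
[cite: BorelJacquet1979, §4.1 (`G(𝔸) = G_∞ × G(𝔸_f)`)]
-/

set_option linter.dupNamespace false -- the mandated namespace repeats `HodgeConjecture.HodgeConjecture`

open Literature.NumberTheory.Automorphic Literature.NumberTheory.Automorphic.UnitaryGroup
open Literature.NumberTheory.GaloisRepresentations
open Literature.NumberTheory.GelbartRogawski1991 Literature.NumberTheory.GelbartRogawski1991.GRConstruction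
open Literature.NumberTheory.K2Lit.SiegelDoubled
-- `Classical` is needed to see the Mathlib normed-ring instances on `mixedSpace L` (note H5 of `AdelicGLnGlue`)
open scoped Classical
open scoped Matrix ComplexOrder
open NumberField NumberField.mixedEmbedding NumberField.InfinitePlace IsDedekindDomain

namespace Summit.HodgeConjecture.HodgeConjecture.Cruxes.HLiu418.K2LiuIwasawaHeightArchReduction

open Summit.HodgeConjecture.HodgeConjecture.Cruxes.HLiu418.K2LiuArchOneParameterOrbitDefs
open Summit.HodgeConjecture.HodgeConjecture.Cruxes.HLiu418.K2LiuSiegelGramDeterminantDefs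
open Summit.HodgeConjecture.HodgeConjecture.Cruxes.HLiu418.K2LiuSiegelGramDeterminant
open Summit.HodgeConjecture.HodgeConjecture.Cruxes.HLiu418.K2LiuIwasawaHeightContinuous
open Summit.HodgeConjecture.HodgeConjecture.Cruxes.HLiu418.K2LiuSiegelMainOrbitOpenEmbeddingArchPrelims (isSiegelDelta_archToAdelic_iff)
open Summit.HodgeConjecture.HodgeConjecture.Cruxes.HLiu418.K2LiuIwasawaDeltaUnimodular (IwasawaDatum.modDelta_eq_one_of_mem)

variable (L : Type) [Field L] [NumberField L] [IsCMField L]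
variable {N M n : ℕ} (e : Fin N × Fin M ≃ Fin n)
  (dV : Fin N → L) (hdV : ∀ i, IsCMField.complexConj L (dV i) = dV i) (hdV0 : ∀ i, dV i ≠ 0)
  (dW : Fin M → L) (hdW : ∀ i, IsCMField.complexConj L (dW i) = dW i) (hdW0 : ∀ i, dW i ≠ 0)

/-! ## 1. Standard data: the components of `K` lie in `K`; the height ignores finite `K`-factors -/

section Std

variable {L e dV hdV dW hdW}
variable {𝒦 : IwasawaDatum L e dV hdV dW hdW}

/-- for a standard datum, the archimedean component `(k_∞, 1)` of `k ∈ K` lies in `K`. [cite: BorelJacquet1979, §4.1] [cite: Tan1999, §1 p. 166] -/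
theorem archEmb_archPart_mem (h𝒦 : 𝒦.IsStd) {k : HA L e dV hdV dW hdW} (hk : k ∈ 𝒦.K) :
    archEmb (Fp L) L (IsCMField.complexConj L) (n + n) (hermD L e dV hdV dW hdW)
      (archPart (Fp L) L (IsCMField.complexConj L) (n + n) (hermD L e dV hdV dW hdW) k) ∈ 𝒦.K := by
  have h := h𝒦.archToAdelic_mul_finAdelicToAdelic_mem hk 𝒦.K.one_mem
  have h1 : finPart (Fp L) L (IsCMField.complexConj L) (n + n) (hermD L e dV hdV dW hdW) (1 : HA L e dV hdV dW hdW) = 1 := map_one _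
  rw [h1, map_one, mul_one] at h
  exact h

/-- for a standard datum, the finite component `(1, k_f)` of `k ∈ K` lies in `K`. [cite: BorelJacquet1979, §4.1] [cite: Tan1999, §1 p. 166] -/
theorem finEmb_finPart_mem (h𝒦 : 𝒦.IsStd) {k : HA L e dV hdV dW hdW} (hk : k ∈ 𝒦.K) :
    finEmb (Fp L) L (IsCMField.complexConj L) (n + n) (hermD L e dV hdV dW hdW)
      (finPart (Fp L) L (IsCMField.complexConj L) (n + n) (hermD L e dV hdV dW hdW) k) ∈ 𝒦.K := by
  have h := h𝒦.archToAdelic_mul_finAdelicToAdelic_mem 𝒦.K.one_mem hk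
  have h1 : archPart (Fp L) L (IsCMField.complexConj L) (n + n) (hermD L e dV hdV dW hdW) (1 : HA L e dV hdV dW hdW) = 1 := map_one _
  rw [h1, map_one, one_mul] at h
  exact h

end Std

/-! ## 2. The components of a Siegel element are Siegel -/

section Components

/-- the archimedean component `(p_∞, 1)` of `p ∈ P_Δ(𝔸)` lies in `P_Δ(𝔸)` (the Siegel relation is entrywise linear, hence holds in the
archimedean coordinate). [cite: GelbartRogawski1991, §3.1 Prop. 3.1.1 p. 455] [cite: BorelJacquet1979, §4.1] -/
theorem isSiegelDelta_archEmb_archPart {p : HA L e dV hdV dW hdW} (hp : IsSiegelDelta L e dV hdV dW hdW p) :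
    IsSiegelDelta L e dV hdV dW hdW (archEmb (Fp L) L (IsCMField.complexConj L) (n + n) (hermD L e dV hdV dW hdW)
      (archPart (Fp L) L (IsCMField.complexConj L) (n + n) (hermD L e dV hdV dW hdW) p)) := by
  rw [archEmb_eq_archToAdelic, isSiegelDelta_archToAdelic_iff]
  have hM : IsSiegelM (((p : GL (Fin (n + n)) (AdeleRing (𝓞 L) L)) : Matrix (Fin (n + n)) (Fin (n + n)) (AdeleRing (𝓞 L) L))) := hp
  have h1 := (hM.map (n := n) (RingHom.fst (InfiniteAdeleRing L) (FiniteAdeleRing (𝓞 L) L))).map (n := n)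
    (InfiniteAdeleRing.ringEquiv_mixedSpace L).toRingHom
  have h2 : ((((p : GL (Fin (n + n)) (AdeleRing (𝓞 L) L)) : Matrix (Fin (n + n)) (Fin (n + n)) (AdeleRing (𝓞 L) L)).map
      (RingHom.fst (InfiniteAdeleRing L) (FiniteAdeleRing (𝓞 L) L))).map (InfiniteAdeleRing.ringEquiv_mixedSpace L).toRingHom) =
      ((archPart (Fp L) L (IsCMField.complexConj L) (n + n) (hermD L e dV hdV dW hdW) p :
        arch (Fp L) L (IsCMField.complexConj L) (n + n) (hermD L e dV hdV dW hdW)) : GL (Fin (n + n)) (mixedSpace L)) :=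
    Matrix.ext fun i j => rfl
  exact (congrArg IsSiegelM h2).mp h1

/-- the finite component `(1, p_f)` of `p ∈ P_Δ(𝔸)` lies in `P_Δ(𝔸)`. [cite: GelbartRogawski1991, §3.1 Prop. 3.1.1 p. 455] [cite: BorelJacquet1979, §4.1] -/
theorem isSiegelDelta_finEmb_finPart {p : HA L e dV hdV dW hdW} (hp : IsSiegelDelta L e dV hdV dW hdW p) :
    IsSiegelDelta L e dV hdV dW hdW (finEmb (Fp L) L (IsCMField.complexConj L) (n + n) (hermD L e dV hdV dW hdW)
      (finPart (Fp L) L (IsCMField.complexConj L) (n + n) (hermD L e dV hdV dW hdW) p)) := by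
  rw [finEmb_eq_finAdelicToAdelic, isSiegelDelta_finAdelicToAdelic_iff]
  have hM : IsSiegelM (((p : GL (Fin (n + n)) (AdeleRing (𝓞 L) L)) : Matrix (Fin (n + n)) (Fin (n + n)) (AdeleRing (𝓞 L) L))) := hp
  exact hM.map (n := n) (RingHom.snd (InfiniteAdeleRing L) (FiniteAdeleRing (𝓞 L) L))

end Components

/-! ## 3. Reduction of the height along the orbit to an archimedean Siegel element -/

section Reduction

variable (𝒦 : IwasawaDatum L e dV hdV dW hdW)
variable {X : Matrix (Fin (n + n)) (Fin (n + n)) (mixedSpace L)}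
  (hX : X ∈ archSkew (Fp L) L (IsCMField.complexConj L) (n + n) (hermD L e dV hdV dW hdW))

/-- the orbit point `h · γ_X(t)` rewritten through the Iwasawa decomposition `h = p k`, `k = (k_∞,1)(1,k_f)`:
`h · γ_X t = p · (k_∞ exp tX, 1) · (1, k_f)`. [cite: BorelJacquet1979, §4.1] [cite: KudlaRallis1994, §1] -/
theorem mul_archExp_eq (h : HA L e dV hdV dW hdW) (t : ℝ) :
    h * archExp (Fp L) L (IsCMField.complexConj L) (n + n) (hermD L e dV hdV dW hdW) hX t =
      𝒦.pPart h *
        archEmb (Fp L) L (IsCMField.complexConj L) (n + n) (hermD L e dV hdV dW hdW)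
          (archPart (Fp L) L (IsCMField.complexConj L) (n + n) (hermD L e dV hdV dW hdW) (𝒦.kPart h) *
            ⟨expGL (t • X), expGL_smul_mem_arch (hermD L e dV hdV dW hdW) hX t⟩) *
        finEmb (Fp L) L (IsCMField.complexConj L) (n + n) (hermD L e dV hdV dW hdW)
          (finPart (Fp L) L (IsCMField.complexConj L) (n + n) (hermD L e dV hdV dW hdW) (𝒦.kPart h)) := by
  conv_lhs => rw [← 𝒦.pPart_mul_kPart h, ← archEmb_mul_finEmb (Fp L) L (IsCMField.complexConj L) (n + n) (hermD L e dV hdV dW hdW) (𝒦.kPart h)]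
  rw [archExp_eq_archEmb, map_mul, mul_assoc, mul_assoc, mul_assoc, mul_assoc, archEmb_mul_finEmb_comm]

include hdV0 hdW0 in
/-- **the height along the orbit factors through an archimedean element**: `Φ_𝒦 (h · γ_X t) = Φ_𝒦 h · Φ_𝒦 ((c_h · exp tX, 1))` with
`c_h = (𝒦.kPart h)_∞` (for a STANDARD datum: `(1, k_f) ∈ K` is dropped by right `K`-invariance, `p` comes out by left `P_Δ`-equivariance).
[cite: KudlaRallis1994, §1] [cite: Tan1999, §1 p. 166] -/
theorem iwasawaHeight_mul_archExp (h𝒦 : 𝒦.IsStd) (h : HA L e dV hdV dW hdW) (t : ℝ) :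
    modDelta L e dV hdV dW hdW (𝒦.pPart (h * archExp (Fp L) L (IsCMField.complexConj L) (n + n) (hermD L e dV hdV dW hdW) hX t)) =
      modDelta L e dV hdV dW hdW (𝒦.pPart h) *
        modDelta L e dV hdV dW hdW (𝒦.pPart
          (archEmb (Fp L) L (IsCMField.complexConj L) (n + n) (hermD L e dV hdV dW hdW)
            (archPart (Fp L) L (IsCMField.complexConj L) (n + n) (hermD L e dV hdV dW hdW) (𝒦.kPart h) *
              ⟨expGL (t • X), expGL_smul_mem_arch (hermD L e dV hdV dW hdW) hX t⟩))) := by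
  rw [mul_archExp_eq L e dV hdV dW hdW 𝒦 hX h t, iwasawaHeight_mul_K L e dV hdV hdV0 dW hdW hdW0 𝒦 _ (finEmb_finPart_mem h𝒦 (𝒦.kPart_mem h)),
    iwasawaHeight_delta_mul L e dV hdV hdV0 dW hdW hdW0 𝒦 (𝒦.pPart_isSiegelDelta h)]

include hdV0 hdW0 in
/-- `Φ_𝒦 ((c, 1)) = 1` for `c = (k)_∞`, `k ∈ K` (standard data). [cite: Tan1999, §1 p. 166] -/
theorem iwasawaHeight_archEmb_archPart (h𝒦 : 𝒦.IsStd) {k : HA L e dV hdV dW hdW} (hk : k ∈ 𝒦.K) :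
    modDelta L e dV hdV dW hdW (𝒦.pPart (archEmb (Fp L) L (IsCMField.complexConj L) (n + n) (hermD L e dV hdV dW hdW)
      (archPart (Fp L) L (IsCMField.complexConj L) (n + n) (hermD L e dV hdV dW hdW) k))) = 1 :=
  iwasawaHeight_of_mem_K L e dV hdV hdV0 dW hdW hdW0 𝒦 (archEmb_archPart_mem h𝒦 hk)

include hdV0 hdW0 in
/-- **the height of an archimedean element is the modulus of an archimedean Siegel element**: for `y ∈ H_∞` with Iwasawa decomposition
`(y,1) = p k`, the element `g := y · (k_∞)⁻¹` satisfies `(g,1) ∈ P_Δ(𝔸)`, `(k_∞,1) ∈ K`, and `Φ_𝒦((y,1)) = modDelta((g,1))` — the finite part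
`(1, p_f) = (1, k_f)⁻¹ ∈ K ∩ P_Δ(𝔸)` of `p` has modulus `1`. [cite: KudlaRallis1994, §1] [cite: Tan1999, §1 p. 166] -/
theorem iwasawaHeight_archEmb_eq (h𝒦 : 𝒦.IsStd) (y : arch (Fp L) L (IsCMField.complexConj L) (n + n) (hermD L e dV hdV dW hdW)) :
    IsSiegelDelta L e dV hdV dW hdW (archEmb (Fp L) L (IsCMField.complexConj L) (n + n) (hermD L e dV hdV dW hdW)
        (y * (archPart (Fp L) L (IsCMField.complexConj L) (n + n) (hermD L e dV hdV dW hdW)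
          (𝒦.kPart (archEmb (Fp L) L (IsCMField.complexConj L) (n + n) (hermD L e dV hdV dW hdW) y)))⁻¹)) ∧
      archEmb (Fp L) L (IsCMField.complexConj L) (n + n) (hermD L e dV hdV dW hdW)
          (archPart (Fp L) L (IsCMField.complexConj L) (n + n) (hermD L e dV hdV dW hdW)
            (𝒦.kPart (archEmb (Fp L) L (IsCMField.complexConj L) (n + n) (hermD L e dV hdV dW hdW) y))) ∈ 𝒦.K ∧
      modDelta L e dV hdV dW hdW (𝒦.pPart (archEmb (Fp L) L (IsCMField.complexConj L) (n + n) (hermD L e dV hdV dW hdW) y)) =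
        modDelta L e dV hdV dW hdW (archEmb (Fp L) L (IsCMField.complexConj L) (n + n) (hermD L e dV hdV dW hdW)
          (y * (archPart (Fp L) L (IsCMField.complexConj L) (n + n) (hermD L e dV hdV dW hdW)
            (𝒦.kPart (archEmb (Fp L) L (IsCMField.complexConj L) (n + n) (hermD L e dV hdV dW hdW) y)))⁻¹)) := by
  -- abbreviations (no new definitions)
  set aE := archEmb (Fp L) L (IsCMField.complexConj L) (n + n) (hermD L e dV hdV dW hdW) with haE
  set fE := finEmb (Fp L) L (IsCMField.complexConj L) (n + n) (hermD L e dV hdV dW hdW) with hfE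
  set aP := archPart (Fp L) L (IsCMField.complexConj L) (n + n) (hermD L e dV hdV dW hdW) with haP
  set fP := finPart (Fp L) L (IsCMField.complexConj L) (n + n) (hermD L e dV hdV dW hdW) with hfP
  set p := 𝒦.pPart (aE y) with hp
  set k := 𝒦.kPart (aE y) with hk
  have hpk : p * k = aE y := 𝒦.pPart_mul_kPart (aE y)
  have hpS : IsSiegelDelta L e dV hdV dW hdW p := 𝒦.pPart_isSiegelDelta (aE y)
  have hkK : k ∈ 𝒦.K := 𝒦.kPart_mem (aE y)
  -- `p = (y,1) · k⁻¹`, so `p_∞ = y · k_∞⁻¹` and `p_f = k_f⁻¹`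
  have hpeq : p = aE y * k⁻¹ := by rw [← hpk, mul_inv_cancel_right]
  have hparch : aP p = y * (aP k)⁻¹ :=
    calc aP p = aP (aE y * k⁻¹) := by rw [hpeq]
      _ = aP (aE y) * aP k⁻¹ := map_mul aP _ _
      _ = aP (aE y) * (aP k)⁻¹ := by rw [show aP k⁻¹ = (aP k)⁻¹ from map_inv aP k]
      _ = y * (aP k)⁻¹ := by rw [haP, haE, archPart_archEmb]
  have hpfin : fP p = (fP k)⁻¹ :=
    calc fP p = fP (aE y * k⁻¹) := by rw [hpeq]
      _ = fP (aE y) * fP k⁻¹ := map_mul fP _ _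
      _ = fP (aE y) * (fP k)⁻¹ := by rw [show fP k⁻¹ = (fP k)⁻¹ from map_inv fP k]
      _ = (fP k)⁻¹ := by rw [hfP, haE, finPart_archEmb, one_mul]
  -- the components of `p` are Siegel
  have hSinf : IsSiegelDelta L e dV hdV dW hdW (aE (y * (aP k)⁻¹)) := by
    rw [← hparch]; exact isSiegelDelta_archEmb_archPart L e dV hdV dW hdW hpS
  have hSf : IsSiegelDelta L e dV hdV dW hdW (fE (fP p)) := isSiegelDelta_finEmb_finPart L e dV hdV dW hdW hpS
  -- the finite component lies in `K`, hence has modulus `1`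
  have hfK : fE (fP p) ∈ 𝒦.K := by
    rw [hpfin, map_inv]
    exact 𝒦.K.inv_mem (finEmb_finPart_mem h𝒦 hkK)
  have hmodf : modDelta L e dV hdV dW hdW (fE (fP p)) = 1 :=
    IwasawaDatum.modDelta_eq_one_of_mem L e dV hdV hdV0 dW hdW hdW0 𝒦 _ hfK hSf
  refine ⟨hSinf, archEmb_archPart_mem h𝒦 hkK, ?_⟩
  -- `modDelta p = modDelta (p_∞,1) · modDelta (1,p_f)`
  have hdec : p = aE (aP p) * fE (fP p) := (archEmb_mul_finEmb (Fp L) L (IsCMField.complexConj L) (n + n) (hermD L e dV hdV dW hdW) p).symm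
  have hSinf' : IsSiegelDelta L e dV hdV dW hdW (aE (aP p)) := isSiegelDelta_archEmb_archPart L e dV hdV dW hdW hpS
  calc modDelta L e dV hdV dW hdW p = modDelta L e dV hdV dW hdW (aE (aP p) * fE (fP p)) := by rw [← hdec]
    _ = modDelta L e dV hdV dW hdW (aE (aP p)) * modDelta L e dV hdV dW hdW (fE (fP p)) := modDelta_mul L e dV hdV dW hdW hSinf' hSf
    _ = modDelta L e dV hdV dW hdW (aE (y * (aP k)⁻¹)) := by rw [hmodf, mul_one, hparch]

end Reduction

/-! ## 4. The archimedean modulus through the Gram determinant, place by place -/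

section Places

/-- **unitarity at a complex place**: if `U ∈ U(1)(L ⊗ ℝ)` (the compact unitary group of the identity form, as in (P2) of ★ `IwasawaDatum.IsStd`)
then its `w`-component is a unitary matrix: `U_wᴴ U_w = 1`. [cite: Weil1964, Chap. I n° 8] [cite: BorelJacquet1979, §4.1] -/
theorem conjTranspose_mul_self_of_mem_arch_one {U : GL (Fin (n + n)) (mixedSpace L)}
    (hU : U ∈ arch (Fp L) L (IsCMField.complexConj L) (n + n) (1 : Matrix (Fin (n + n)) (Fin (n + n)) L))
    (w : {w : InfinitePlace L // w.IsComplex}) (hw : IsCMField.complexConj L • w.1 = w.1) :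
    ((Matrix.GeneralLinearGroup.map (evalC L w) U : GL (Fin (n + n)) ℂ) : Matrix (Fin (n + n)) (Fin (n + n)) ℂ)ᴴ *
        ((Matrix.GeneralLinearGroup.map (evalC L w) U : GL (Fin (n + n)) ℂ) : Matrix (Fin (n + n)) (Fin (n + n)) ℂ) = 1 := by
  have h := map_mem_unitaryGroupOfForm (σ := conjMixed (Fp L) L (IsCMField.complexConj L)) (τ := starRingEnd ℂ) (evalC L w)
    (evalC_conjMixed (Fp L) L (IsCMField.complexConj L) hw (IsCMField.complexConj_ne_one L)) hU
  rw [mem_unitaryGroupOfForm_iff, archFormOf_map_evalC, Matrix.map_one _ (map_zero _) (map_one _), Matrix.mul_one] at h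
  exact h

variable (𝒦 : IwasawaDatum L e dV hdV dW hdW)

/-- **the Gram identity at a complex place**: for `y, c ∈ H_∞` with `(y c⁻¹, 1) ∈ P_Δ(𝔸)` and `S⁻¹ c S ∈ U(1)` (majorant frame `S`),
`‖det_Δ ((y c⁻¹)_w)‖² · siegelGram S_w⁻¹ y_w⁻¹ = siegelGram S_w⁻¹ 1` (★ B2: `siegelGram S_w⁻¹ y_w⁻¹ = siegelGram S_w⁻¹ (y c⁻¹)_w⁻¹` by unitary
invariance, and `siegelGram S_w⁻¹ ((y c⁻¹)_w⁻¹ (y c⁻¹)_w) = |det_Δ|² · siegelGram S_w⁻¹ (y c⁻¹)_w⁻¹` by `P_Δ`-equivariance).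
[cite: Weil1964, Chap. I n° 8] [cite: KudlaRallis1994, §1] -/
theorem normSq_detDeltaM_mul_siegelGram (S : GL (Fin (n + n)) (mixedSpace L))
    {y c : arch (Fp L) L (IsCMField.complexConj L) (n + n) (hermD L e dV hdV dW hdW)}
    (hcU : S⁻¹ * (c : GL (Fin (n + n)) (mixedSpace L)) * S ∈
      arch (Fp L) L (IsCMField.complexConj L) (n + n) (1 : Matrix (Fin (n + n)) (Fin (n + n)) L))
    (hg : IsSiegelDelta L e dV hdV dW hdW (archEmb (Fp L) L (IsCMField.complexConj L) (n + n) (hermD L e dV hdV dW hdW) (y * c⁻¹)))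
    (w : {w : InfinitePlace L // w.IsComplex}) (hw : IsCMField.complexConj L • w.1 = w.1) :
    ‖detDeltaM (((Matrix.GeneralLinearGroup.map (evalC L w) ((y * c⁻¹ : arch (Fp L) L (IsCMField.complexConj L) (n + n)
        (hermD L e dV hdV dW hdW)) : GL (Fin (n + n)) (mixedSpace L)) : GL (Fin (n + n)) ℂ) : Matrix (Fin (n + n)) (Fin (n + n)) ℂ))‖ ^ 2 *
        (siegelGram (((Matrix.GeneralLinearGroup.map (evalC L w) S)⁻¹ : GL (Fin (n + n)) ℂ) : Matrix (Fin (n + n)) (Fin (n + n)) ℂ)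
          (((Matrix.GeneralLinearGroup.map (evalC L w) (y : GL (Fin (n + n)) (mixedSpace L)))⁻¹ : GL (Fin (n + n)) ℂ) :
            Matrix (Fin (n + n)) (Fin (n + n)) ℂ)).re =
      (siegelGram (((Matrix.GeneralLinearGroup.map (evalC L w) S)⁻¹ : GL (Fin (n + n)) ℂ) : Matrix (Fin (n + n)) (Fin (n + n)) ℂ) 1).re := by
  -- the `w`-components
  set f := Matrix.GeneralLinearGroup.map (n := Fin (n + n)) (evalC L w) with hf
  set Sw : GL (Fin (n + n)) ℂ := f S with hSw
  set cw : GL (Fin (n + n)) ℂ := f (c : GL (Fin (n + n)) (mixedSpace L)) with hcw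
  set yw : GL (Fin (n + n)) ℂ := f (y : GL (Fin (n + n)) (mixedSpace L)) with hyw
  set gw : GL (Fin (n + n)) ℂ := f ((y * c⁻¹ : arch (Fp L) L (IsCMField.complexConj L) (n + n) (hermD L e dV hdV dW hdW)) :
    GL (Fin (n + n)) (mixedSpace L)) with hgw
  have hgw' : gw = yw * cw⁻¹ := by rw [hgw, Subgroup.coe_mul, Subgroup.coe_inv, map_mul, map_inv]
  -- `g_w` is Siegel
  have hgS : IsSiegelM ((gw : GL (Fin (n + n)) ℂ) : Matrix (Fin (n + n)) (Fin (n + n)) ℂ) := by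
    rw [archEmb_eq_archToAdelic, isSiegelDelta_archToAdelic_iff] at hg
    exact hg.map (n := n) (evalC L w)
  -- the unitary `V = (S_w⁻¹ c_w S_w)⁻¹`
  set Uu : GL (Fin (n + n)) ℂ := Sw⁻¹ * cw * Sw with hUu
  have hU1 : ((Uu : GL (Fin (n + n)) ℂ) : Matrix (Fin (n + n)) (Fin (n + n)) ℂ)ᴴ * (Uu : Matrix (Fin (n + n)) (Fin (n + n)) ℂ) = 1 := by
    have h := conjTranspose_mul_self_of_mem_arch_one L hcU w hw
    rw [map_mul, map_mul, map_inv] at h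
    exact h
  have hUinv : ((Uu⁻¹ : GL (Fin (n + n)) ℂ) : Matrix (Fin (n + n)) (Fin (n + n)) ℂ) = (Uu : Matrix (Fin (n + n)) (Fin (n + n)) ℂ)ᴴ := by
    rw [Matrix.coe_units_inv]
    exact Matrix.inv_eq_left_inv hU1
  have hV : (((Uu⁻¹ : GL (Fin (n + n)) ℂ) : Matrix (Fin (n + n)) (Fin (n + n)) ℂ))ᴴ * ((Uu⁻¹ : GL (Fin (n + n)) ℂ) : Matrix _ _ ℂ) = 1 := by
    rw [hUinv, Matrix.conjTranspose_conjTranspose, ← hUinv, ← Units.val_mul, mul_inv_cancel, Units.val_one]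
  have hTC : ((Sw⁻¹ : GL (Fin (n + n)) ℂ) : Matrix (Fin (n + n)) (Fin (n + n)) ℂ) * ((cw⁻¹ : GL (Fin (n + n)) ℂ) : Matrix _ _ ℂ) =
      ((Uu⁻¹ : GL (Fin (n + n)) ℂ) : Matrix (Fin (n + n)) (Fin (n + n)) ℂ) * ((Sw⁻¹ : GL (Fin (n + n)) ℂ) : Matrix _ _ ℂ) := by
    rw [← Units.val_mul, ← Units.val_mul, hUu]
    congr 1
    group
  -- unitary invariance: `F(y) = F(g)`
  have h1 : siegelGram ((Sw⁻¹ : GL (Fin (n + n)) ℂ) : Matrix (Fin (n + n)) (Fin (n + n)) ℂ) ((yw⁻¹ : GL (Fin (n + n)) ℂ) : Matrix _ _ ℂ) =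
      siegelGram ((Sw⁻¹ : GL (Fin (n + n)) ℂ) : Matrix (Fin (n + n)) (Fin (n + n)) ℂ) ((gw⁻¹ : GL (Fin (n + n)) ℂ) : Matrix _ _ ℂ) := by
    have hy : ((yw⁻¹ : GL (Fin (n + n)) ℂ) : Matrix (Fin (n + n)) (Fin (n + n)) ℂ) =
        ((cw⁻¹ : GL (Fin (n + n)) ℂ) : Matrix (Fin (n + n)) (Fin (n + n)) ℂ) * ((gw⁻¹ : GL (Fin (n + n)) ℂ) : Matrix _ _ ℂ) := by
      rw [← Units.val_mul, hgw', mul_inv_rev, inv_inv, inv_mul_cancel_left]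
    rw [hy, siegelGram_mul_left_of_unitary _ _ _ _ hV hTC]
  -- `P_Δ`-equivariance at `Y = g_w⁻¹`, `P = g_w`
  have h2 := siegelGram_mul_right_of_isSiegelM ((Sw⁻¹ : GL (Fin (n + n)) ℂ) : Matrix (Fin (n + n)) (Fin (n + n)) ℂ)
    ((gw⁻¹ : GL (Fin (n + n)) ℂ) : Matrix (Fin (n + n)) (Fin (n + n)) ℂ) hgS
  rw [← Units.val_mul, inv_mul_cancel, Units.val_one, Complex.star_def, Complex.conj_mul'] at h2
  -- real parts
  obtain ⟨r, -, hr⟩ := siegelGram_pos ((Sw⁻¹ : GL (Fin (n + n)) ℂ) : Matrix (Fin (n + n)) (Fin (n + n)) ℂ)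
    ((gw⁻¹ : GL (Fin (n + n)) ℂ) : Matrix (Fin (n + n)) (Fin (n + n)) ℂ) (Units.isUnit _) (Units.isUnit _)
  rw [h1, h2, hr, ← Complex.ofReal_pow, ← Complex.ofReal_mul, Complex.ofReal_re, Complex.ofReal_re]

include hdV0 hdW0 in
/-- **THE SQUARE OF THE IWASAWA HEIGHT OF AN ARCHIMEDEAN ELEMENT THROUGH GRAM DETERMINANTS** (standard data): for the majorant frame `S` and
compact `C_∞ = {a | S⁻¹ a S ∈ U(1)}` of (P2) (with `(𝒦.K)_∞ ≤ C_∞`), and every `y ∈ H_∞`,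
`Φ_𝒦((y,1))² = ∏_{v real ∣ L⁺} siegelGram S_{w(v)}⁻¹ 1 ∕ siegelGram S_{w(v)}⁻¹ y_{w(v)}⁻¹`, `w(v) = placeOver v`.
[cite: KudlaRallis1994, §1] [cite: Weil1964, Chap. I n° 8] [cite: Tan1999, §1 p. 166] -/
theorem iwasawaHeight_archEmb_sq (h𝒦 : 𝒦.IsStd)
    {Cinf : Subgroup (arch (Fp L) L (IsCMField.complexConj L) (n + n) (hermD L e dV hdV dW hdW))}
    {S : GL (Fin (n + n)) (mixedSpace L)}
    (hC : ∀ a : arch (Fp L) L (IsCMField.complexConj L) (n + n) (hermD L e dV hdV dW hdW),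
      a ∈ Cinf ↔ S⁻¹ * (a : GL (Fin (n + n)) (mixedSpace L)) * S ∈
        arch (Fp L) L (IsCMField.complexConj L) (n + n) (1 : Matrix (Fin (n + n)) (Fin (n + n)) L))
    (hKC : ∀ k : HA L e dV hdV dW hdW, k ∈ 𝒦.K →
      archPart (Fp L) L (IsCMField.complexConj L) (n + n) (hermD L e dV hdV dW hdW) k ∈ Cinf)
    (y : arch (Fp L) L (IsCMField.complexConj L) (n + n) (hermD L e dV hdV dW hdW)) :
    modDelta L e dV hdV dW hdW (𝒦.pPart (archEmb (Fp L) L (IsCMField.complexConj L) (n + n) (hermD L e dV hdV dW hdW) y)) ^ 2 =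
      ∏ v : {v : InfinitePlace (Fp L) // v.IsReal},
        (siegelGram (((Matrix.GeneralLinearGroup.map (evalC L (placeOver L v)) S)⁻¹ : GL (Fin (n + n)) ℂ) :
            Matrix (Fin (n + n)) (Fin (n + n)) ℂ) 1).re /
          (siegelGram (((Matrix.GeneralLinearGroup.map (evalC L (placeOver L v)) S)⁻¹ : GL (Fin (n + n)) ℂ) :
              Matrix (Fin (n + n)) (Fin (n + n)) ℂ)
            (((Matrix.GeneralLinearGroup.map (evalC L (placeOver L v)) (y : GL (Fin (n + n)) (mixedSpace L)))⁻¹ :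
              GL (Fin (n + n)) ℂ) : Matrix (Fin (n + n)) (Fin (n + n)) ℂ)).re := by
  obtain ⟨hS, hcK, hΦ⟩ := iwasawaHeight_archEmb_eq L e dV hdV hdV0 dW hdW hdW0 𝒦 h𝒦 y
  set c := archPart (Fp L) L (IsCMField.complexConj L) (n + n) (hermD L e dV hdV dW hdW)
    (𝒦.kPart (archEmb (Fp L) L (IsCMField.complexConj L) (n + n) (hermD L e dV hdV dW hdW) y)) with hc
  have hcU := (hC c).1 (hKC _ (𝒦.kPart_mem _))
  rw [hΦ, archEmb_eq_archToAdelic,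
    modDelta_archToAdelic_sq L e dV hdV dW hdW (IsCMField.complexConj_ne_one L) (placeOver L)
      (fun v => complexConj_smul_infinitePlace L (placeOver L v).1) (placeOver_comap L) (y * c⁻¹) hS]
  refine Finset.prod_congr rfl fun v _ => ?_
  have key := normSq_detDeltaM_mul_siegelGram L e dV hdV dW hdW S hcU hS (placeOver L v)
    (complexConj_smul_infinitePlace L (placeOver L v).1)
  obtain ⟨r, hr0, hr⟩ := siegelGram_pos
    (((Matrix.GeneralLinearGroup.map (evalC L (placeOver L v)) S)⁻¹ : GL (Fin (n + n)) ℂ) : Matrix (Fin (n + n)) (Fin (n + n)) ℂ)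
    (((Matrix.GeneralLinearGroup.map (evalC L (placeOver L v)) (y : GL (Fin (n + n)) (mixedSpace L)))⁻¹ : GL (Fin (n + n)) ℂ) :
      Matrix (Fin (n + n)) (Fin (n + n)) ℂ) (Units.isUnit _) (Units.isUnit _)
  have hpos : 0 < (siegelGram
      (((Matrix.GeneralLinearGroup.map (evalC L (placeOver L v)) S)⁻¹ : GL (Fin (n + n)) ℂ) : Matrix (Fin (n + n)) (Fin (n + n)) ℂ)
      (((Matrix.GeneralLinearGroup.map (evalC L (placeOver L v)) (y : GL (Fin (n + n)) (mixedSpace L)))⁻¹ : GL (Fin (n + n)) ℂ) :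
        Matrix (Fin (n + n)) (Fin (n + n)) ℂ)).re := by
    rw [hr, Complex.ofReal_re]; exact hr0
  rw [eq_div_iff hpos.ne', ← key]
  rfl

end Places

end Summit.HodgeConjecture.HodgeConjecture.Cruxes.HLiu418.K2LiuIwasawaHeightArchReduction
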